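import Literature.IUT.HodgeArakelov.MonoThetaProjectiveProp16EllipticRefIdentityWitness
import Literature.AnabelianGeometry.AbsoluteAnabelian.AbsTopII.EllipticCuspidalizationTF
import Literature.AnabelianGeometry.AbsoluteAnabelian.FreeProSigmaTorsionFree
import Literature.AnabelianGeometry.AbsoluteAnabelian.AbsTopILem45iModelProofs
import HarnessLib

/-!
# [IUTchII] Prop. 1.6 (ii) / [AbsTopII] Cor. 3.3 (iii): the identity (no-cusp) output record over the PRINT-FAITHFUL
# successor `EllipticCuspidalizationTF` — INHABITED at free pro-`Σ` `Δ` (finding T1g11-F1 at layer L6)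

Cell `abc-iut` (run/shared/lean/pub/abc-iut/), layer L6, seat abc-iut-L6-d7 (gen 14); junction row MERGE-MAP v55 §8S
**B18** «[IUTchII] Prop 1.6 (i)/(ii) reference clauses (R2)/(R2′)/(core) → `AbsTopII.EllipticCuspidalizationTF`»
(abc-iut-L6-t7 census `T1G11-F1-L6-IMPACT.md`, repair menu (M1), item «identity-TF witness»). ONE definition
(`identityRecordTF`, a construction — no `Prop`-valued named fact, no instance, no notation) + theorems; nothing landed
is edited.

S. Mochizuki, *Inter-universal Teichmüller Theory II*, kurims manuscript (Dec. 2020), §1, Prop. 1.6 (ii) p. 31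
l. 34–41 ("… `Π ↦ {Π_{U_N}(Π) ↠ Π}` … such that when `Π = Π^tp_{X̲̲_k}`, the surjection `Π_{U_N}(Π) ↠ Π` may be
naturally identified with a certain surjection — i.e., “elliptic cuspidalization” — … [cf. [AbsTopII], Corollary 3.3,
(iii)]") [claim: Mochizuki2012, status: disputed] (IUTchII §1 Prop 1.6 (ii), kurims p.31); S. Mochizuki, *Topics in
Absolute Anabelian Geometry II*, Cor. 3.3 pp. 67–69, (ii) p. 68: "… open subgroups `J ⊆ Π_C` of index `2` such that
`J ∩ Δ_C` is torsion-free [i.e., the covering determined by `J` is a scheme — cf. [AbsTopI], Lemma 4.1, (iv)]"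
[cite: MochizukiAbsTopII2013, Cor 3.3 pp.67-69]; S. Mochizuki, *Topics in Absolute Anabelian Geometry I*, Lemma 4.5
(i) p. 54 ("free pro-`Σ`") [cite: MochizukiAbsTopI2012, Lemma 4.5 (i) p.54].

## The defect this file answers (OUR typing, not print)
abc-iut-L4-t6's FROZEN output record `AbsTopII.EllipticCuspidalization E` of [AbsTopII] Cor. 3.3 (iii) types clause
(ii) as `torsionFree_PiD : IsMulTorsionFree ↥(Π_D ⊓ Δ_C)` — Mathlib's UNIQUE-ROOTS class. KERNEL (abc-iut-L4-t17,
`Summit.ABC.IUTFork.isEmpty_ellipticCuspidalization_of_isFreeProOn`, p499351): over every `E` whose `Δ` is free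
pro-`Σ` of rank `≥ 2` with two primes in `Σ` — the shape of `Π̂` of an AFFINE hyperbolic curve, i.e. of print's
`Π^tp_{X̲̲_k}` — that record type is EMPTY; hence abc-iut-L6-t21's identity record
`EllipticCuspidalization.IdentityWitness.identityRecord (htf : IsMulTorsionFree E.geom)` (p447116) has an UNSATISFIABLE
hypothesis there, and the [IUTchII] Prop. 1.6 (ii) successor predicate `RefIsElliptic` (clause (R2), abc-iut-w5-d030)
is FALSE at such `X` (p499351 `refIsElliptic_false_of_isFreeProOn_deltaHat`). abc-iut-L4-t4's PRINT-FAITHFUL successor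
`AbsTopII.EllipticCuspidalizationTF E` (p496811) keeps the 27 other fields VERBATIM and replaces (ii) by
`∀ g : ↥(Π_D ⊓ Δ_C), IsOfFinOrder g → g = 1` («no non-trivial element of finite order»), with the one-way bridge
`EllipticCuspidalization.toTF`.

## What is shown
* `torsionFree_prod_top_bot_inf_geom` — in the core `Π × ℤ/2` of the identity record, an element of
  `(Π × 1) ∩ (Δ × ℤ/2)` of finite order is trivial as soon as `Δ` has no non-trivial element of finite order
  (`htf⁰ : ∀ g : ↥E.geom, IsOfFinOrder g → g = 1`, print's wording; abc-iut-L5-t1's currency).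
* **`identityRecordTF (N) (htf⁰) (V) (hVo) (hVc) : AbsTopII.EllipticCuspidalizationTF E`** — the identity / no-cusp
  record of abc-iut-L6-t21 (core `Π × ℤ/2`, `Π_D = Π × 1`, `Π_V = V` a centre-free normal open subgroup, `Π_U = Π_{U_X}
  = Π`, cuspidalization `proj = 𝟙`, NO cusps, label `N`, `Σ = ℕ`) over the TF record, field (ii) from `htf⁰`; the 27
  other fields are the same terms as in `identityRecord`.
* **`toTF_identityRecord : (identityRecord E N htf V hVo hVc).toTF = identityRecordTF E N _ V hVo hVc`** (`rfl`) —
  abc-iut-L4-t4's bridge carries the frozen identity record DEFINITIONALLY onto this one (unique roots ⇒ `htf⁰`).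
* `identityRecordTF_N`, `identityRecordTF_proj`, `identityRecordTF_proj_arith_apply`, `isEmpty_cusps_identityRecordTF`
  — the record's label is `N`, its cuspidalization is the identity, it has no cusps.
* **`nonempty_ellipticCuspidalizationTF_of_isFreeProOn`** — if `Δ = E.geom` is free pro-`Σ` of finite rank (ANY
  `Σ`, ANY rank; [AbsTopI] Lem. 4.5 (i) vocabulary `IsFreeProOn`), then `htf⁰` is a THEOREM (abc-iut-L4's
  `IsFreeProOn.torsionFree`, `FreeProSigmaTorsionFree.lean`) and `AbsTopII.EllipticCuspidalizationTF E` is INHABITED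
  for every centre-free normal open `V`; slim form `…_of_center_eq_bot` (`V := Π`, `Π` centre-free — slimness).
  So at exactly the free data where p499351 EMPTIES the frozen record (rank `≥ 2`, two primes in `Σ`), the successor
  record is inhabited: the T1g11-F1 separation now holds at the level of the Cor. 3.3 (iii) OUTPUT RECORD, not only
  at clause (ii) (abc-iut-L4's `inf_geom_torsionFree_of_geom` vs
  `Summit.ABC.IUTFork.not_mem_semiEllipticDoubleCoverSubgroups_of_isFreeProOn`).
* `nonempty_ellipticCuspidalizationTF_of_deltaHat_isFreeProOn` — the same read on a tempered curve `X` of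
  abc-iut-L3's [SemiAnbd] §6 interface through a junction datum `iX : Π̂_X ≃ₜ* E.arith` matching `Δ̂_X` with `Δ`
  (hypothesis `hfree : IsFreeProOn ↥X.DeltaHat Σ gens` = p499351's, the classical input «`Δ̂` of an affine hyperbolic
  curve is free profinite», [SGA1] XIII 2.12, carried in the tree as abc-iut-L5's hypothesis field
  `GeomOrigin.isFreeProOn`; the transport `Δ̂_X ≃ Δ` along `iX` of p499351 is inlined, since a Literature file
  cannot import a `Summits` module).

READING (numbers, not adjectives; RQ7 T1 «inhabited from degeneracy» carried forward): the inhabitant is the DEGENERATE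
one (removed-cusp set `R = ∅`, `proj = 𝟙`, `N` a free label). A re-point of (R2)/(R2′)/(core) to the TF record
(MERGE-MAP B18, menu (M1): L6 statement file `…Prop16RefTF`) therefore restores SATISFIABILITY of the v1 predicate at
genuine shape through this record, while the v2 chain predicate's exclusion of identity-shaped outputs
(`RefIsEllipticChain.not_of_refHom_eq_self`, abc-iut-L6-t2) remains the content gate: satisfiable ≠ content.
HONEST SCOPE: statements about OUR typed objects at free pro-`Σ` geometric data; the (R0)/(R1) content of the Prop. 1.6
predicates is untouched; uninhabited/inhabited-as-typed is not a claim about [AbsTopII] Cor. 3.3 or [IUTchII] Prop. 1.6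
in print; no side is taken on [IUTchIII] Cor. 3.12; typed ≠ proved; nothing here asserts that abc is proved or refuted.
-/

noncomputable section

open CategoryTheory Topology

namespace Literature.IUT.HodgeArakelov

namespace EllipticCuspidalization

namespace IdentityWitness

open Literature.AnabelianGeometry.AbsoluteAnabelian
open Literature.AnabelianGeometry.SemiGraphs (TemperedCurve)

/-! ## §1. The identity record over `EllipticCuspidalizationTF` (every extension `E`, print-faithful torsion-freeness) -/

section L4

variable (E : FundamentalExtension.{0})

/-- In the core `Π × ℤ/2` of the identity record, an element of `(Π × 1) ∩ (Δ × ℤ/2)` of finite order is trivial as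
soon as `Δ` has no non-trivial element of finite order — clause (ii) "`J ∩ Δ_C` is torsion-free" in PRINT's wording for
`J := Π × 1`. [cite: MochizukiAbsTopII2013, Cor 3.3 (ii) p.68] -/
theorem torsionFree_prod_top_bot_inf_geom (htf : ∀ g : ↥E.geom, IsOfFinOrder g → g = 1)
    (g : ↥(((⊤ : Subgroup E.arith).prod (⊥ : Subgroup C2)) ⊓ (coreExt E).geom)) (hg : IsOfFinOrder g) :
    g = 1 := by
  obtain ⟨⟨a1, a2⟩, ha⟩ := g
  have ha' := Subgroup.mem_inf.1 ha
  have ha2 : a2 = 1 := Subgroup.mem_bot.1 (Subgroup.mem_prod.1 ha'.1).2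
  have ha1 : a1 ∈ E.geom := ha'.2
  let π : ↥(((⊤ : Subgroup E.arith).prod (⊥ : Subgroup C2)) ⊓ (coreExt E).geom) →* E.arith :=
    (MonoidHom.fst E.arith C2).comp (Subgroup.subtype _)
  have h1 : IsOfFinOrder a1 := by
    have := π.isOfFinOrder hg
    simpa [π] using this
  have h2 : IsOfFinOrder (⟨a1, ha1⟩ : ↥E.geom) := (E.geom.subtype_injective).isOfFinOrder_iff.mp h1
  have h3 : a1 = 1 := congrArg Subtype.val (htf _ h2)
  subst h3 ha2
  rfl

/-- Pulling a subgroup back along the identity morphism of `E` does nothing. [folklore] -/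
private theorem comap_id_arith_eq_self (V : Subgroup E.arith) :
    V.comap (𝟙 E : E ⟶ E).arith.toMonoidHom = V :=
  Subgroup.ext fun _ => Iff.rfl

/-- `Π_V ↦ Π_V × 1 ↦ Π_V`: pull-back of the push-forward along the injection `x ↦ (x, 1)`. [folklore] -/
private theorem comap_map_toCore_eq_self (V : Subgroup E.arith) :
    (V.map (toCore E).arith.toMonoidHom).comap (toCore E).arith.toMonoidHom = V :=
  Subgroup.comap_map_eq_self_of_injective (toCore_arith_injective E) V

variable {E} in
/-- Transport of `center = ⊥` along an equality of subgroups. [folklore] -/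
private theorem center_eq_bot_of_subgroup_eq {G : Type*} [Group G] {H K : Subgroup G} (h : H = K)
    (hK : Subgroup.center K = ⊥) : Subgroup.center H = ⊥ := by
  subst h
  exact hK

/-- **The identity / no-cusp [AbsTopII] Cor. 3.3 (iii) OUTPUT RECORD over the PRINT-FAITHFUL successor
`EllipticCuspidalizationTF`**, label `N`, over any extension `E` whose `Δ` has no non-trivial element of finite order
("torsion-free", print's wording) and which has a centre-free normal open subgroup `V`: core `Π × ℤ/2`, `Π_D = Π × 1`
(open, index `2`, `Π_D ∩ Δ_C ≅ Δ` torsion-free), `Π_V = V`, `Π_U = Π` with `Π_U ↠ Π_D` the inclusion `x ↦ (x,1)`,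
`Π_{U_X} = Π` with `proj = 𝟙`, no cusps, `Σ = ℕ`. The 27 fields other than (ii) are the SAME TERMS as abc-iut-L6-t21's
`identityRecord` over the frozen record. [cite: MochizukiAbsTopII2013, Cor 3.3 (iii) p.68] -/
def identityRecordTF (N : ℕ+) (htf : ∀ g : ↥E.geom, IsOfFinOrder g → g = 1) (V : Subgroup E.arith)
    [hVn : V.Normal] (hVo : IsOpen (V : Set E.arith)) (hVc : Subgroup.center V = ⊥) :
    AbsTopII.EllipticCuspidalizationTF E where
  N := N
  Sigma := Set.univ
  N_isSigmaInteger := ⟨N.pos, fun _ _ _ => Set.mem_univ _⟩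
  core := coreExt E
  toCore := toCore E
  toCore_isOpenInjective :=
    { arith_injective := toCore_arith_injective E
      isOpen_range_arith := by
        have h : Set.range (toCore E).arith = (((⊤ : Subgroup E.arith).prod (⊥ : Subgroup C2) :
            Subgroup (E.arith × C2)) : Set (E.arith × C2)) := by
          rw [← range_toCore_arith E]; rfl
        rw [h]
        exact isOpen_prod_top_bot E
      gal_injective := Function.injective_id
      isOpen_range_gal := by
        have h : Set.range (toCore E).gal = Set.univ := Set.range_eq_univ.2 Function.surjective_id
        rw [h]; exact isOpen_univ }
  toCore_gal_bijective := Function.bijective_id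
  PiD := (⊤ : Subgroup E.arith).prod (⊥ : Subgroup C2)
  isOpen_PiD := isOpen_prod_top_bot E
  index_PiD := index_prod_top_bot E
  torsionFree_PiD := torsionFree_prod_top_bot_inf_geom E htf
  PiV := V
  normal_PiV := hVn
  isOpen_PiV := hVo
  map_PiV_le := by
    rintro _ ⟨v, -, rfl⟩
    exact Subgroup.mem_prod.2 ⟨Subgroup.mem_top _, Subgroup.mem_bot.2 rfl⟩
  cuspU := E
  projU := toCore E
  range_projU := range_toCore_arith E
  projU_gal_bijective := Function.bijective_id
  cuspUX := E
  proj := 𝟙 E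
  proj_arith_surjective := Function.surjective_id
  proj_gal_bijective := Function.bijective_id
  glue := (MulEquiv.subgroupCongr (comap_id_arith_eq_self E V)).trans
    (MulEquiv.subgroupCongr (comap_map_toCore_eq_self E V).symm)
  glue_comm _ := rfl
  lifting_unique ρ ρ' _ _ hρ hρ' := by
    ext g
    obtain ⟨a, ha, hax⟩ := hρ g
    obtain ⟨a', ha', hax'⟩ := hρ' g
    have haa : a = a' := by
      ext x
      exact (hax x).trans (hax' x).symm
    rw [← ha, ← ha', haa]
  center_PiUV_eq_bot := center_eq_bot_of_subgroup_eq (Subgroup.ext fun _ => Iff.rfl) hVc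
  cusps :=
    { Cusp := PEmpty.{1}
      Dcusp := fun x => x.elim
      Icusp := fun x => x.elim
      Icusp_eq := fun x => x.elim
      isClosed_Dcusp := fun x => x.elim
      eq_of_conj := fun x => x.elim }

/-- **The bridge carries the frozen identity record onto this one, definitionally**: unique roots ⇒ no non-trivial
element of finite order (`IsOfFinOrder.eq_one'`), all other fields the same terms.
[cite: MochizukiAbsTopII2013, Cor 3.3 (ii) p.68] -/
theorem toTF_identityRecord (N : ℕ+) (htf : IsMulTorsionFree E.geom) (V : Subgroup E.arith) [V.Normal]
    (hVo : IsOpen (V : Set E.arith)) (hVc : Subgroup.center V = ⊥) :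
    (identityRecord E N htf V hVo hVc).toTF =
      identityRecordTF E N (fun _ hg => by haveI := htf; exact hg.eq_one') V hVo hVc := rfl

/-- The TF record's label is `N`. [cite: MochizukiAbsTopII2013, Cor 3.3 (iii) p.68] -/
theorem identityRecordTF_N (N : ℕ+) (htf : ∀ g : ↥E.geom, IsOfFinOrder g → g = 1) (V : Subgroup E.arith)
    [V.Normal] (hVo : IsOpen (V : Set E.arith)) (hVc : Subgroup.center V = ⊥) :
    (identityRecordTF E N htf V hVo hVc).N = (N : ℕ) := rfl

/-- The TF record has NO cusps. [cite: MochizukiAbsTopII2013, Cor 3.3 (iii)(c) p.69] -/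
theorem isEmpty_cusps_identityRecordTF (N : ℕ+) (htf : ∀ g : ↥E.geom, IsOfFinOrder g → g = 1)
    (V : Subgroup E.arith) [V.Normal] (hVo : IsOpen (V : Set E.arith)) (hVc : Subgroup.center V = ⊥) :
    IsEmpty (identityRecordTF E N htf V hVo hVc).cusps.Cusp :=
  ⟨fun x => by cases x⟩

/-- The TF record's cuspidalization `Π_{U_X} ↠ Π` is the identity. [cite: MochizukiAbsTopII2013, Cor 3.3 (iii) p.68] -/
theorem identityRecordTF_proj (N : ℕ+) (htf : ∀ g : ↥E.geom, IsOfFinOrder g → g = 1) (V : Subgroup E.arith)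
    [V.Normal] (hVo : IsOpen (V : Set E.arith)) (hVc : Subgroup.center V = ⊥) :
    (identityRecordTF E N htf V hVo hVc).proj = 𝟙 E := rfl

/-- … so on elements it is the identity map. [cite: MochizukiAbsTopII2013, Cor 3.3 (iii) p.68] -/
theorem identityRecordTF_proj_arith_apply (N : ℕ+) (htf : ∀ g : ↥E.geom, IsOfFinOrder g → g = 1)
    (V : Subgroup E.arith) [V.Normal] (hVo : IsOpen (V : Set E.arith)) (hVc : Subgroup.center V = ⊥)
    (x : E.arith) : (identityRecordTF E N htf V hVo hVc).proj.arith x = x := by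
  rw [identityRecordTF_proj]; rfl

/-! ## §2. The GENUINE inhabitant: free pro-`Σ` `Δ` -/

/-- **At free pro-`Σ` `Δ` the TF record IS INHABITED.** If `Δ = E.geom` is free pro-`Σ` of finite rank on `gens`
(ANY `Σ`, ANY rank `n`), then `Δ` has no non-trivial element of finite order (`IsFreeProOn.torsionFree`), so the identity
record inhabits `AbsTopII.EllipticCuspidalizationTF E` for every centre-free normal open `V` — whereas for rank `≥ 2`
and two primes in `Σ` the FROZEN record `AbsTopII.EllipticCuspidalization E` is EMPTY
(`Summit.ABC.IUTFork.isEmpty_ellipticCuspidalization_of_isFreeProOn`). [cite: MochizukiAbsTopII2013, Cor 3.3 (iii) p.68] -/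
theorem nonempty_ellipticCuspidalizationTF_of_isFreeProOn {S : Set ℕ} {n : ℕ} {gens : Fin n → ↥E.geom}
    (hfree : IsFreeProOn ↥E.geom S gens) (N : ℕ+) (V : Subgroup E.arith) [V.Normal]
    (hVo : IsOpen (V : Set E.arith)) (hVc : Subgroup.center V = ⊥) :
    Nonempty (AbsTopII.EllipticCuspidalizationTF E) := by
  haveI : CompactSpace ↥E.geom := isCompact_iff_compactSpace.mp E.isClosed_geom.isCompact
  exact ⟨identityRecordTF E N hfree.torsionFree V hVo hVc⟩

/-- Centre of `Π` trivial ⇒ centre of the improper subgroup `⊤ ≤ Π` trivial. [folklore] -/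
private theorem center_top_eq_bot_of_center_eq_bot {G : Type*} [Group G] (h : Subgroup.center G = ⊥) :
    Subgroup.center (⊤ : Subgroup G) = ⊥ := by
  refine eq_bot_iff.2 fun z hz => ?_
  have hz' : (z : G) ∈ Subgroup.center G := by
    rw [Subgroup.mem_center_iff]
    intro g
    exact congrArg Subtype.val (Subgroup.mem_center_iff.1 hz ⟨g, Subgroup.mem_top g⟩)
  rw [h] at hz'
  exact Subgroup.mem_bot.2 (Subtype.ext (Subgroup.mem_bot.1 hz'))

/-- **Slim form** (`V := Π` itself): free pro-`Σ` `Δ` and centre-free `Π` (slimness, as for every hyperbolic curve)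
give an inhabitant of the TF record. [cite: MochizukiAbsTopII2013, Cor 3.3 (iii) p.68] -/
theorem nonempty_ellipticCuspidalizationTF_of_isFreeProOn_of_center_eq_bot {S : Set ℕ} {n : ℕ}
    {gens : Fin n → ↥E.geom} (hfree : IsFreeProOn ↥E.geom S gens) (N : ℕ+)
    (hZ : Subgroup.center E.arith = ⊥) : Nonempty (AbsTopII.EllipticCuspidalizationTF E) :=
  nonempty_ellipticCuspidalizationTF_of_isFreeProOn E hfree N ⊤ (by rw [Subgroup.coe_top]; exact isOpen_univ)
    (center_top_eq_bot_of_center_eq_bot hZ)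

end L4

/-! ## §3. Read on a tempered curve `X` through a junction datum `Π̂_X ≃ E.arith` -/

section L6

variable {p : ℕ} [Fact p.Prime]

/-- **At a tempered curve `X` whose `Δ̂_X` is free pro-`Σ`** (print's `X̲̲_k`, an affine hyperbolic curve; the
classical input carried as abc-iut-L5's `GeomOrigin.isFreeProOn`), every junction datum `(E, iX)` for `Π̂_X` matching
`Δ̂_X`, with a centre-free normal open `V ≤ E.arith`, carries an inhabitant of the PRINT-FAITHFUL [AbsTopII] Cor. 3.3
(iii) output record — the identity record of label `N`. (The transport `Δ̂_X ≃ₜ* Δ` along `iX` is abc-iut-L4-t17's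
`Summit.ABC.IUTFork.isFreeProOn_geom_of_deltaHat`, p499351, inlined: a Literature file cannot import a `Summits`
module.) [cite: MochizukiAbsTopII2013, Cor 3.3 (iii) p.68] -/
theorem nonempty_ellipticCuspidalizationTF_of_deltaHat_isFreeProOn (X : TemperedCurve p)
    {E : FundamentalExtension.{0}} (iX : X.PiHat ≃ₜ* E.arith)
    (hgeom : ∀ z : X.PiHat, iX z ∈ E.geom ↔ z ∈ X.DeltaHat)
    {S : Set ℕ} {n : ℕ} {gens : Fin n → ↥X.DeltaHat} (hfree : IsFreeProOn ↥X.DeltaHat S gens) (N : ℕ+)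
    (V : Subgroup E.arith) [V.Normal] (hVo : IsOpen (V : Set E.arith)) (hVc : Subgroup.center V = ⊥) :
    Nonempty (AbsTopII.EllipticCuspidalizationTF E) := by
  let e : ↥X.DeltaHat ≃ₜ* ↥E.geom :=
    { toFun := fun z => ⟨iX z, (hgeom z).2 z.2⟩
      invFun := fun w => ⟨iX.symm w, (hgeom (iX.symm w)).1 (by
        rw [ContinuousMulEquiv.apply_symm_apply]; exact w.2)⟩
      left_inv := fun z => Subtype.ext (iX.symm_apply_apply z)
      right_inv := fun w => Subtype.ext (iX.apply_symm_apply w)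
      map_mul' := fun z w => Subtype.ext (map_mul iX _ _)
      continuous_toFun := (iX.continuous.comp continuous_subtype_val).subtype_mk _
      continuous_invFun := (iX.symm.continuous.comp continuous_subtype_val).subtype_mk _ }
  exact nonempty_ellipticCuspidalizationTF_of_isFreeProOn E (gens := fun i => e (gens i))
    (IsFreeProOn.of_continuousMulEquiv hfree e) N V hVo hVc

end L6

end IdentityWitness

end EllipticCuspidalization

end Literature.IUT.HodgeArakelov

end
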